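import Summits.QuantumFields.YangMills.Theorems.BalabanUVNodesN14LawChannelTunedPathImplicit
import Summits.QuantumFields.YangMills.Theorems.BalabanUVNodesN19TiltPathEndpoints

/-!
# BalabanUVNodes ∕ node N14 = NE1′ — LENS control CARD 11, THE N14-LANE REMAINDER (III-b): K11c′ — EXISTENCE OF THE TUNED COUNTERTERM PATH

Cell `pub-ymgap`, HUMAN RULING D-0062 (Track A at full width), seat `pub-ymgap-dag-n14-c` (R134 ACCELERATION, strategy s1), generation 7 (idle re-seat);
route `Summits/QuantumFields/YangMills/Theses/BalabanUVNodes.lean` rev 18∕19 (cluster K3⁗ `SpineGivenEndpointR13Sep` = stmt-QuantumFields-20292,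
`--kind proof --supports … --as helper`); venue ruling R424 (`YangMills/Theorems`, namespace `YMDAG.N14.LawChannelTunedPath`, continued).  ADDITIVE — imports
(III-a) `…N14LawChannelTunedPathImplicit` (the monotone implicit-function lemma `exists_C1_zeroCurve`) and dag-n19-c's module II `…N19TiltPathEndpoints` (which
brings module I `…N19TiltPathCalculus`: Feynman–Hellmann along a general tilt path, `hasDerivAt_integral_tilted_tiltPath_eq_cov`, `integral_tilted_eq_div` — CITED);
THEOREMS ONLY (0 `def`), modifies nothing.

SOURCE OF RECORD.  LENS control v6.0 §B (B3) (planner seat `ym-lens-BalabanUVNodes-control` g7, memo `LENS-control.md` v6.0 b6dee8b86c4ff517; farm-checked sketch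
`Sketch-control-g7.lean` d9b91efbe9c6728d §3 «K11c′ — EXISTENCE OF THE TUNED PATH (implicit-function shape)» — SIGNATURE LIFTED VERBATIM WITH CREDIT; row s17
«free to lift with credit, idle-seat only»; lens g8 GO-17 note (b) «K11c′ stays memo»; dag-n19-c `…N19TiltPathEndpoints` header + `feedbackLaw_of_tuned` docstring
«existence ∕ C¹-regularity of κ = the lens's K11c′, an N14-lane memo item, NOT typed here»).  The body is this seat's.

WHAT THIS IS.
* §4 [folklore ∘ module I] THE COUNTERTERMED CHORD AS A TWO-PARAMETER EXPONENTIAL FAMILY `(u, v) ↦ μ.tilted (s·F + u·D + v·S)` (bounded measurable `F, D, S, R`,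
  probability `μ`): `measurable_chord`, `abs_chord_le`, ★ `hasDerivAt_integral_chord_u` ∕ `hasDerivAt_integral_chord_v` (the partial derivatives of the tilted mean
  of `R` are the covariances with `D` and with `S` — module I's Feynman–Hellmann on each one-parameter sub-family), `continuous_integral_mul_exp_chord` (joint
  continuity of the weighted integrals on `ℝ²`, dominated convergence on unit balls), `cov_chord_eq`, ★ `continuous_cov_chord` (joint continuity of
  `(u, v) ↦ Cov_{u,v}(R, g)`).
* §5 ★★ **K11c′ `exists_tuned_path`** (signature verbatim) and its window-recording form `exists_tuned_path_mem_Icc`: if on the strip `u ∈ [0,1]`, `|v| ≤ V` the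
  response of the renormalisation observable `R` to the marginal monomial `S` is uniformly positive (`Cov_{u,v}(R, S) ≥ γ > 0`), the window brackets the target `r`
  at `v = ±V`, and both endpoints are tuned (`∫ R dμ.tilted (sF) = r = ∫ R dμ.tilted (sF + D)`), then there is a C¹ counterterm `κ : ℝ → ℝ` (`κ′` continuous on `ℝ`)
  with `κ 0 = κ 1 = 0` (and `κ([0,1]) ⊆ [-V, V]`) holding `∫ R dμ.tilted (s·F + u·D + κ(u)·S) = r` for every `u ∈ [0,1]` — the input `κ` of K11-FH ∕ K11a ∕ K11c
  (dag-n19-c `…N19TiltPathEndpoints` §2) and of K11b (`…N14LawChannelTuned` §1): one application of (III-a) `exists_C1_zeroCurve` to `G(u,v) = ∫ R dμ.tilted(…) − r`.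

WHAT THIS IS NOT.  Everything here is PROVED (0 `sorry`, 0 named facts) on hypothesis shapes.  The countertermed chord is LENS control's CURRENCY (F2″) — «a repaired
currency, NOT an estimate, NOT on N14's critical path; it gains only in PRODUCTION» (memo §B (B3); lens HANDOFF gen 9 (D3)); the uniform response `γ`, the bracket `V`
and the tuned endpoints are what a PRODUCER must supply at the record (Bałaban's run laws, the one-step defect, the Wilson monomial — NODE O ∕ NE5–NE7 objects); nothing
of Bałaban's is instantiated; N14 ∕ N19 NOT discharged; count-neutral.  One finite four-torus programme at fixed ε; NOT ℝ⁴, NOT OS, NOT a mass gap, NOT Clay.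
-/

set_option autoImplicit false

noncomputable section

namespace YMDAG.N14.LawChannelTunedPath

open MeasureTheory ProbabilityTheory Set Filter Topology
open scoped ENNReal
open Summit.QuantumFields.YangMills.BalabanUVNodes.N19TiltPathCalculus (integrable_of_abs_le integral_tilted_eq_div
  hasDerivAt_integral_tilted_tiltPath_eq_cov)

/-! ## §4 The countertermed chord as a TWO-parameter exponential family `(u, v) ↦ μ.tilted (s·F + u·D + v·S)`: partial derivatives and joint continuity -/
section Chord

variable {Ω : Type*} [MeasurableSpace Ω] {μ : Measure Ω} [IsProbabilityMeasure μ] {F D S R g : Ω → ℝ} {B₀ CD CS CR Cg s : ℝ}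

/-- The exponent of the chord is measurable. -/
theorem measurable_chord (hFm : Measurable F) (hDm : Measurable D) (hSm : Measurable S) (u v : ℝ) :
    Measurable fun x => s * F x + u * D x + v * S x :=
  ((measurable_const.mul hFm).add (measurable_const.mul hDm)).add (measurable_const.mul hSm)

omit [MeasurableSpace Ω] [IsProbabilityMeasure μ] in
/-- The exponent of the chord is bounded, uniformly on bounded parameter sets: `|s·F + u·D + v·S| ≤ |s|·B₀ + |u|·C_D + |v|·C_S`. -/
theorem abs_chord_le (hFb : ∀ x, |F x| ≤ B₀) (hDb : ∀ x, |D x| ≤ CD) (hSb : ∀ x, |S x| ≤ CS) (u v : ℝ) (x : Ω) :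
    |s * F x + u * D x + v * S x| ≤ |s| * B₀ + |u| * CD + |v| * CS := by
  have t1 : |s * F x| ≤ |s| * B₀ := by rw [abs_mul]; exact mul_le_mul_of_nonneg_left (hFb x) (abs_nonneg s)
  have t2 : |u * D x| ≤ |u| * CD := by rw [abs_mul]; exact mul_le_mul_of_nonneg_left (hDb x) (abs_nonneg u)
  have t3 : |v * S x| ≤ |v| * CS := by rw [abs_mul]; exact mul_le_mul_of_nonneg_left (hSb x) (abs_nonneg v)
  calc |s * F x + u * D x + v * S x| ≤ |s * F x + u * D x| + |v * S x| := abs_add_le _ _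
    _ ≤ |s * F x| + |u * D x| + |v * S x| := by linarith [abs_add_le (s * F x) (u * D x)]
    _ ≤ |s| * B₀ + |u| * CD + |v| * CS := by linarith

/-- **THE `u`-PARTIAL OF THE TILTED MEAN IS THE COVARIANCE WITH `D`** (module I's Feynman–Hellmann on the `u`-family at fixed `v`). [folklore] -/
theorem hasDerivAt_integral_chord_u (hRm : Measurable R) (hRb : ∀ x, |R x| ≤ CR) (hFm : Measurable F) (hFb : ∀ x, |F x| ≤ B₀)
    (hDm : Measurable D) (hDb : ∀ x, |D x| ≤ CD) (hSm : Measurable S) (hSb : ∀ x, |S x| ≤ CS) (u v : ℝ) :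
    HasDerivAt (fun t : ℝ => ∫ x, R x ∂(μ.tilted fun x => s * F x + t * D x + v * S x))
      (cov[R, D; μ.tilted fun x => s * F x + u * D x + v * S x]) u := by
  have key := hasDerivAt_integral_tilted_tiltPath_eq_cov (μ := μ) (u₀ := u) (ψ := fun t x => s * F x + t * D x + v * S x)
    (ψ' := fun _ x => D x) (fun t => measurable_chord hFm hDm hSm t v) (fun _ => hDm)
    (fun t x => by
      have h := ((hasDerivAt_id t).mul_const (D x)).const_add (s * F x) |>.add_const (v * S x)
      simpa using h)
    ⟨1, one_pos, |s| * B₀ + (|u| + 1) * CD + |v| * CS + CD, fun t ht x => by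
      have ht' : |t| ≤ |u| + 1 := by
        rw [Metric.mem_ball, Real.dist_eq] at ht
        calc |t| = |(t - u) + u| := by ring_nf
          _ ≤ |t - u| + |u| := abs_add_le _ _
          _ ≤ |u| + 1 := by linarith
      have hCD : 0 ≤ CD := (abs_nonneg _).trans (hDb x)
      constructor
      · calc |s * F x + t * D x + v * S x| ≤ |s| * B₀ + |t| * CD + |v| * CS := abs_chord_le hFb hDb hSb t v x
          _ ≤ |s| * B₀ + (|u| + 1) * CD + |v| * CS + CD := by nlinarith [abs_nonneg (D x)]
      · calc |D x| ≤ CD := hDb x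
          _ ≤ _ := by nlinarith [abs_nonneg s, abs_nonneg v, abs_nonneg u, (abs_nonneg _).trans (hFb x),
              (abs_nonneg _).trans (hSb x)]⟩
    hRm hRb
  exact key

/-- **THE `v`-PARTIAL OF THE TILTED MEAN IS THE COVARIANCE WITH `S`** (module I's Feynman–Hellmann on the `v`-family at fixed `u`). [folklore] -/
theorem hasDerivAt_integral_chord_v (hRm : Measurable R) (hRb : ∀ x, |R x| ≤ CR) (hFm : Measurable F) (hFb : ∀ x, |F x| ≤ B₀)
    (hDm : Measurable D) (hDb : ∀ x, |D x| ≤ CD) (hSm : Measurable S) (hSb : ∀ x, |S x| ≤ CS) (u v : ℝ) :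
    HasDerivAt (fun t : ℝ => ∫ x, R x ∂(μ.tilted fun x => s * F x + u * D x + t * S x))
      (cov[R, S; μ.tilted fun x => s * F x + u * D x + v * S x]) v := by
  have key := hasDerivAt_integral_tilted_tiltPath_eq_cov (μ := μ) (u₀ := v) (ψ := fun t x => s * F x + u * D x + t * S x)
    (ψ' := fun _ x => S x) (fun t => measurable_chord hFm hDm hSm u t) (fun _ => hSm)
    (fun t x => by
      have h := ((hasDerivAt_id t).mul_const (S x)).const_add (s * F x + u * D x)
      simpa using h)
    ⟨1, one_pos, |s| * B₀ + |u| * CD + (|v| + 1) * CS + CS, fun t ht x => by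
      have ht' : |t| ≤ |v| + 1 := by
        rw [Metric.mem_ball, Real.dist_eq] at ht
        calc |t| = |(t - v) + v| := by ring_nf
          _ ≤ |t - v| + |v| := abs_add_le _ _
          _ ≤ |v| + 1 := by linarith
      have hCS : 0 ≤ CS := (abs_nonneg _).trans (hSb x)
      constructor
      · calc |s * F x + u * D x + t * S x| ≤ |s| * B₀ + |u| * CD + |t| * CS := abs_chord_le hFb hDb hSb u t x
          _ ≤ |s| * B₀ + |u| * CD + (|v| + 1) * CS + CS := by nlinarith [abs_nonneg (S x)]
      · calc |S x| ≤ CS := hSb x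
          _ ≤ _ := by nlinarith [abs_nonneg s, abs_nonneg v, abs_nonneg u, (abs_nonneg _).trans (hFb x),
              (abs_nonneg _).trans (hDb x)]⟩
    hRm hRb
  exact key

/-- **JOINT CONTINUITY OF THE CHORD's WEIGHTED INTEGRALS**: for bounded measurable `g`, `(u, v) ↦ ∫ g·e^{s·F + u·D + v·S} dμ` is continuous on `ℝ²`
(dominated convergence with a constant majorant on unit balls). [folklore] -/
theorem continuous_integral_mul_exp_chord (hgm : Measurable g) (hgb : ∀ x, |g x| ≤ Cg) (hFm : Measurable F) (hFb : ∀ x, |F x| ≤ B₀)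
    (hDm : Measurable D) (hDb : ∀ x, |D x| ≤ CD) (hSm : Measurable S) (hSb : ∀ x, |S x| ≤ CS) :
    Continuous fun p : ℝ × ℝ => ∫ x, g x * Real.exp (s * F x + p.1 * D x + p.2 * S x) ∂μ := by
  refine continuous_iff_continuousAt.2 fun p₀ => ?_
  have hmeas : ∀ p : ℝ × ℝ, AEStronglyMeasurable (fun x => g x * Real.exp (s * F x + p.1 * D x + p.2 * S x)) μ := fun p =>
    (hgm.mul (Real.measurable_exp.comp (measurable_chord hFm hDm hSm p.1 p.2))).aestronglyMeasurable
  set M : ℝ := |s| * B₀ + (|p₀.1| + 1) * CD + (|p₀.2| + 1) * CS with hM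
  refine continuousAt_of_dominated (bound := fun _ => |Cg| * Real.exp M) (Eventually.of_forall hmeas) ?_ (integrable_const _) ?_
  · filter_upwards [Metric.ball_mem_nhds p₀ one_pos] with p hp
    refine Eventually.of_forall fun x => ?_
    rw [Real.norm_eq_abs, abs_mul, Real.abs_exp]
    have hp' : |p.1 - p₀.1| < 1 ∧ |p.2 - p₀.2| < 1 := by
      rw [Metric.mem_ball, Prod.dist_eq, max_lt_iff, Real.dist_eq, Real.dist_eq] at hp; exact hp
    have h1 : |p.1| ≤ |p₀.1| + 1 := by
      calc |p.1| = |(p.1 - p₀.1) + p₀.1| := by ring_nf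
        _ ≤ |p.1 - p₀.1| + |p₀.1| := abs_add_le _ _
        _ ≤ |p₀.1| + 1 := by linarith [hp'.1]
    have h2 : |p.2| ≤ |p₀.2| + 1 := by
      calc |p.2| = |(p.2 - p₀.2) + p₀.2| := by ring_nf
        _ ≤ |p.2 - p₀.2| + |p₀.2| := abs_add_le _ _
        _ ≤ |p₀.2| + 1 := by linarith [hp'.2]
    have hCD : 0 ≤ CD := (abs_nonneg _).trans (hDb x)
    have hCS : 0 ≤ CS := (abs_nonneg _).trans (hSb x)
    refine mul_le_mul ((hgb x).trans (le_abs_self _)) (Real.exp_le_exp.2 ?_) (Real.exp_pos _).le (abs_nonneg _)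
    calc s * F x + p.1 * D x + p.2 * S x ≤ |s * F x + p.1 * D x + p.2 * S x| := le_abs_self _
      _ ≤ |s| * B₀ + |p.1| * CD + |p.2| * CS := abs_chord_le hFb hDb hSb p.1 p.2 x
      _ ≤ M := by rw [hM]; nlinarith
  · exact Eventually.of_forall fun x => ((continuous_const.add ((continuous_fst.mul continuous_const).comp continuous_id)).add
      (continuous_snd.mul continuous_const)).rexp.const_mul (g x) |>.continuousAt

/-- The covariance under the chord's law, as a rational function of the weighted integrals. [folklore; `covariance_eq_sub` + `integral_tilted_eq_div`] -/
theorem cov_chord_eq (hRm : Measurable R) (hRb : ∀ x, |R x| ≤ CR) (hgm : Measurable g) (hgb : ∀ x, |g x| ≤ Cg) (hFm : Measurable F)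
    (hFb : ∀ x, |F x| ≤ B₀) (hDm : Measurable D) (hDb : ∀ x, |D x| ≤ CD) (hSm : Measurable S) (hSb : ∀ x, |S x| ≤ CS) (u v : ℝ) :
    cov[R, g; μ.tilted fun x => s * F x + u * D x + v * S x] =
      (∫ x, (R x * g x) * Real.exp (s * F x + u * D x + v * S x) ∂μ) / (∫ x, Real.exp (s * F x + u * D x + v * S x) ∂μ) -
        (∫ x, R x * Real.exp (s * F x + u * D x + v * S x) ∂μ) / (∫ x, Real.exp (s * F x + u * D x + v * S x) ∂μ) *
          ((∫ x, g x * Real.exp (s * F x + u * D x + v * S x) ∂μ) / (∫ x, Real.exp (s * F x + u * D x + v * S x) ∂μ)) := by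
  set ψ : Ω → ℝ := fun x => s * F x + u * D x + v * S x with hψ
  haveI : IsProbabilityMeasure (μ.tilted ψ) :=
    isProbabilityMeasure_tilted (integrable_of_abs_le (Real.measurable_exp.comp (measurable_chord hFm hDm hSm u v)) fun x => by
      rw [Real.abs_exp]; exact Real.exp_le_exp.2 ((le_abs_self _).trans (abs_chord_le hFb hDb hSb u v x)))
  have hRt : MemLp R 2 (μ.tilted ψ) :=
    MemLp.of_bound hRm.aestronglyMeasurable CR (Eventually.of_forall fun x => by rw [Real.norm_eq_abs]; exact hRb x)
  have hgt : MemLp g 2 (μ.tilted ψ) :=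
    MemLp.of_bound hgm.aestronglyMeasurable Cg (Eventually.of_forall fun x => by rw [Real.norm_eq_abs]; exact hgb x)
  rw [covariance_eq_sub hRt hgt]
  show (∫ x, (R * g) x ∂(μ.tilted ψ)) - (∫ x, R x ∂(μ.tilted ψ)) * (∫ x, g x ∂(μ.tilted ψ)) = _
  rw [integral_tilted_eq_div ψ (R * g), integral_tilted_eq_div ψ R, integral_tilted_eq_div ψ g]
  rfl

/-- **JOINT CONTINUITY OF THE CHORD's COVARIANCES**: for bounded measurable `R`, `g`, `(u, v) ↦ Cov_{μ.tilted (s·F + u·D + v·S)}(R, g)` is continuous on `ℝ²`. [folklore] -/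
theorem continuous_cov_chord (hRm : Measurable R) (hRb : ∀ x, |R x| ≤ CR) (hgm : Measurable g) (hgb : ∀ x, |g x| ≤ Cg) (hFm : Measurable F)
    (hFb : ∀ x, |F x| ≤ B₀) (hDm : Measurable D) (hDb : ∀ x, |D x| ≤ CD) (hSm : Measurable S) (hSb : ∀ x, |S x| ≤ CS) :
    Continuous (Function.uncurry fun u v => cov[R, g; μ.tilted fun x => s * F x + u * D x + v * S x]) := by
  have hZ : ∀ p : ℝ × ℝ, (∫ x, Real.exp (s * F x + p.1 * D x + p.2 * S x) ∂μ) ≠ 0 := fun p =>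
    (integral_exp_pos (integrable_of_abs_le (Real.measurable_exp.comp (measurable_chord hFm hDm hSm p.1 p.2)) fun x => by
      rw [Real.abs_exp]; exact Real.exp_le_exp.2 ((le_abs_self _).trans (abs_chord_le hFb hDb hSb p.1 p.2 x)))).ne'
  have hRg : Continuous fun p : ℝ × ℝ => ∫ x, (R x * g x) * Real.exp (s * F x + p.1 * D x + p.2 * S x) ∂μ :=
    continuous_integral_mul_exp_chord (hRm.mul hgm) (fun x => by
      rw [abs_mul]; exact mul_le_mul (hRb x) (hgb x) (abs_nonneg _) ((abs_nonneg _).trans (hRb x))) hFm hFb hDm hDb hSm hSb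
  have hR1 : Continuous fun p : ℝ × ℝ => ∫ x, R x * Real.exp (s * F x + p.1 * D x + p.2 * S x) ∂μ :=
    continuous_integral_mul_exp_chord hRm hRb hFm hFb hDm hDb hSm hSb
  have hg1 : Continuous fun p : ℝ × ℝ => ∫ x, g x * Real.exp (s * F x + p.1 * D x + p.2 * S x) ∂μ :=
    continuous_integral_mul_exp_chord hgm hgb hFm hFb hDm hDb hSm hSb
  have h1 : Continuous fun p : ℝ × ℝ => ∫ x, Real.exp (s * F x + p.1 * D x + p.2 * S x) ∂μ := by
    have h := continuous_integral_mul_exp_chord (μ := μ) (g := fun _ => (1 : ℝ)) (Cg := 1) (s := s) measurable_const (fun _ => by simp)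
      hFm hFb hDm hDb hSm hSb
    simpa only [one_mul] using h
  have heq : (Function.uncurry fun u v => cov[R, g; μ.tilted fun x => s * F x + u * D x + v * S x]) = fun p : ℝ × ℝ =>
      (∫ x, (R x * g x) * Real.exp (s * F x + p.1 * D x + p.2 * S x) ∂μ) / (∫ x, Real.exp (s * F x + p.1 * D x + p.2 * S x) ∂μ) -
        (∫ x, R x * Real.exp (s * F x + p.1 * D x + p.2 * S x) ∂μ) / (∫ x, Real.exp (s * F x + p.1 * D x + p.2 * S x) ∂μ) *
          ((∫ x, g x * Real.exp (s * F x + p.1 * D x + p.2 * S x) ∂μ) / (∫ x, Real.exp (s * F x + p.1 * D x + p.2 * S x) ∂μ)) := by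
    funext p
    exact cov_chord_eq hRm hRb hgm hgb hFm hFb hDm hDb hSm hSb p.1 p.2
  rw [heq]
  exact (hRg.div h1 hZ).sub ((hR1.div h1 hZ).mul (hg1.div h1 hZ))

end Chord

/-! ## §5 K11c′ — EXISTENCE OF THE TUNED PATH -/
section Tuned

variable {Ω : Type*} [MeasurableSpace Ω] {μ : Measure Ω} [IsProbabilityMeasure μ] {F D S R : Ω → ℝ} {B₀ CD CS CR s r : ℝ}

/-- **K11c′ WITH THE WINDOW — EXISTENCE OF THE TUNED PATH, values in `[-V, V]`.**  As `exists_tuned_path` below, recording in addition that the counterterm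
stays in the window `[-V, V]` on `[0,1]`. [folklore ∘ §3 `exists_C1_zeroCurve` + §4] -/
theorem exists_tuned_path_mem_Icc (hRm : Measurable R) (hRb : ∀ x, |R x| ≤ CR) (hFm : Measurable F) (hFb : ∀ x, |F x| ≤ B₀)
    (hDm : Measurable D) (hDb : ∀ x, |D x| ≤ CD) (hSm : Measurable S) (hSb : ∀ x, |S x| ≤ CS) {γ V : ℝ} (hγ : 0 < γ) (hV : 0 < V)
    (hresp : ∀ u ∈ Set.Icc (0 : ℝ) 1, ∀ v ∈ Set.Icc (-V) V, γ ≤ cov[R, S; μ.tilted fun x => s * F x + u * D x + v * S x])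
    (hbracket : ∀ u ∈ Set.Icc (0 : ℝ) 1, ∫ x, R x ∂(μ.tilted fun x => s * F x + u * D x + (-V) * S x) ≤ r ∧
      r ≤ ∫ x, R x ∂(μ.tilted fun x => s * F x + u * D x + V * S x))
    (h0 : ∫ x, R x ∂(μ.tilted fun x => s * F x) = r) (h1 : ∫ x, R x ∂(μ.tilted fun x => s * F x + D x) = r) :
    ∃ κ κ' : ℝ → ℝ, (∀ u, HasDerivAt κ (κ' u) u) ∧ Continuous κ' ∧ κ 0 = 0 ∧ κ 1 = 0 ∧
      (∀ u ∈ Set.Icc (0 : ℝ) 1, κ u ∈ Set.Icc (-V) V) ∧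
      ∀ u ∈ Set.Icc (0 : ℝ) 1, ∫ x, R x ∂(μ.tilted fun x => s * F x + u * D x + κ u * S x) = r := by
  -- the two-parameter family `G u v = ∫ R dμ.tilted (sF + uD + vS) − r` and its partials
  set G : ℝ → ℝ → ℝ := fun u v => (∫ x, R x ∂(μ.tilted fun x => s * F x + u * D x + v * S x)) - r with hG
  have hGu : ∀ u v, HasDerivAt (fun t => G t v) (cov[R, D; μ.tilted fun x => s * F x + u * D x + v * S x]) u := fun u v =>
    (hasDerivAt_integral_chord_u (μ := μ) (s := s) hRm hRb hFm hFb hDm hDb hSm hSb u v).sub_const r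
  have hGv : ∀ u v, HasDerivAt (fun t => G u t) (cov[R, S; μ.tilted fun x => s * F x + u * D x + v * S x]) v := fun u v =>
    (hasDerivAt_integral_chord_v (μ := μ) (s := s) hRm hRb hFm hFb hDm hDb hSm hSb u v).sub_const r
  have hG0 : G 0 0 = 0 := by
    have e : (fun x => s * F x + (0 : ℝ) * D x + (0 : ℝ) * S x) = fun x => s * F x := by funext x; ring
    simp only [hG, e, h0, sub_self]
  have hG1 : G 1 0 = 0 := by
    have e : (fun x => s * F x + (1 : ℝ) * D x + (0 : ℝ) * S x) = fun x => s * F x + D x := by funext x; ring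
    simp only [hG, e, h1, sub_self]
  have hbr : ∀ u ∈ Icc (0 : ℝ) 1, G u (-V) ≤ 0 ∧ 0 ≤ G u V := fun u hu =>
    ⟨sub_nonpos.2 (hbracket u hu).1, sub_nonneg.2 (hbracket u hu).2⟩
  obtain ⟨κ, κ', hκd, hκ'c, hκ0, hκ1, hκm, hκz⟩ := exists_C1_zeroCurve (G := G) hγ hV hGu hGv
    (continuous_cov_chord hRm hRb hDm hDb hFm hFb hDm hDb hSm hSb) (continuous_cov_chord hRm hRb hSm hSb hFm hFb hDm hDb hSm hSb)
    hresp hbr hG0 hG1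
  exact ⟨κ, κ', hκd, hκ'c, hκ0, hκ1, hκm, fun u hu => sub_eq_zero.1 (hκz u hu)⟩

/-- **K11c′ — EXISTENCE OF THE TUNED PATH** (LENS control CARD 11; signature = `Sketch-control-g7.lean` §3, credited; «implicit-function shape»): if on the strip
`u ∈ [0,1]`, `|v| ≤ V` the response of the renormalisation observable `R` to the marginal monomial is uniformly positive (`Cov_{u,v}(R, S) ≥ γ > 0`), the window
brackets the target value `r`, and BOTH endpoints are tuned to `r` (`v = 0` at `u = 0` and at `u = 1` — at the record: run `K` and run `K+1`'s push-forward obey the same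
renormalisation condition), then a C¹ counterterm `κ` with `κ 0 = κ 1 = 0` holds `R` fixed along the countertermed chord `u ↦ μ.tilted (s·F + u·D + κ(u)·S)`; this is the
`κ` that K11-FH ∕ K11a ∕ K11c (dag-n19-c `…N19TiltPathEndpoints` §2) and K11b (`…N14LawChannelTuned` §1) take as input. [folklore ∘ `exists_tuned_path_mem_Icc`] -/
theorem exists_tuned_path (hRm : Measurable R) (hRb : ∀ x, |R x| ≤ CR) (hFm : Measurable F) (hFb : ∀ x, |F x| ≤ B₀)
    (hDm : Measurable D) (hDb : ∀ x, |D x| ≤ CD) (hSm : Measurable S) (hSb : ∀ x, |S x| ≤ CS) {γ V : ℝ} (hγ : 0 < γ) (hV : 0 < V)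
    (hresp : ∀ u ∈ Set.Icc (0 : ℝ) 1, ∀ v ∈ Set.Icc (-V) V, γ ≤ cov[R, S; μ.tilted fun x => s * F x + u * D x + v * S x])
    (hbracket : ∀ u ∈ Set.Icc (0 : ℝ) 1, ∫ x, R x ∂(μ.tilted fun x => s * F x + u * D x + (-V) * S x) ≤ r ∧
      r ≤ ∫ x, R x ∂(μ.tilted fun x => s * F x + u * D x + V * S x))
    (h0 : ∫ x, R x ∂(μ.tilted fun x => s * F x) = r) (h1 : ∫ x, R x ∂(μ.tilted fun x => s * F x + D x) = r) :
    ∃ κ κ' : ℝ → ℝ, (∀ u, HasDerivAt κ (κ' u) u) ∧ Continuous κ' ∧ κ 0 = 0 ∧ κ 1 = 0 ∧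
      ∀ u ∈ Set.Icc (0 : ℝ) 1, ∫ x, R x ∂(μ.tilted fun x => s * F x + u * D x + κ u * S x) = r := by
  obtain ⟨κ, κ', hκd, hκ'c, hκ0, hκ1, -, hκz⟩ :=
    exists_tuned_path_mem_Icc hRm hRb hFm hFb hDm hDb hSm hSb hγ hV hresp hbracket h0 h1
  exact ⟨κ, κ', hκd, hκ'c, hκ0, hκ1, hκz⟩

end Tuned

/-! ## §6 (v1.1, APPEND-ONLY — §§4–5 byte-identical) The memo's CHORD TARGET and the bracket from the straight chord's DETUNING

LENS control memo §B (B3) words the feedback law as «holding a unit-scale renormalisation observable `R` on the CHORD OF ITS ENDPOINT VALUES»; the sketch's K11c′ (§5, verbatim)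
is the equal-endpoint case `r₀ = r₁ = r`.  §6 types the memo's affine target `(1−u)·r₀ + u·r₁` (one more application of `exists_C1_zeroCurve`, the `u`-partial shifted by the
constant slope `r₁ − r₀`), and replaces the bracket hypothesis at `v = ±V` by the natural PRODUCER-FACING condition: the straight chord's DETUNING of `R` never exceeds the
window's reach `γ·V` (then the growth `γ·V` of `v ↦ ∫ R dμ_{u,v}` across `[0, ±V]` brackets the target). -/
section Affine

variable {Ω : Type*} [MeasurableSpace Ω] {μ : Measure Ω} [IsProbabilityMeasure μ] {F D S R : Ω → ℝ} {B₀ CD CS CR s r₀ r₁ : ℝ}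

/-- **K11c′, AFFINE TARGET** (LENS control memo §B (B3) AS WRITTEN: «`κ_K` from the feedback law holding a unit-scale renormalisation observable `R` on the CHORD OF
ITS ENDPOINT VALUES»): with endpoint means `r₀ = ∫ R dμ.tilted (sF)` and `r₁ = ∫ R dμ.tilted (sF + D)` (NOT assumed equal), a uniformly positive response
`Cov_{u,v}(R, S) ≥ γ` on `[0,1] × [-V, V]` and a bracket of the affine target `(1−u)·r₀ + u·r₁` at `v = ±V` give a C¹ counterterm `κ` on `ℝ` with `κ 0 = κ 1 = 0`,
`κ([0,1]) ⊆ [-V, V]`, holding `∫ R dμ.tilted (s·F + u·D + κ(u)·S) = (1−u)·r₀ + u·r₁` on `[0,1]`.  (`exists_tuned_path` is the case `r₀ = r₁`.)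
[folklore ∘ `exists_C1_zeroCurve` with `G(u,v) = ∫ R dμ.tilted(…) − ((1−u)r₀ + u r₁)`] -/
theorem exists_tuned_path_affine (hRm : Measurable R) (hRb : ∀ x, |R x| ≤ CR) (hFm : Measurable F) (hFb : ∀ x, |F x| ≤ B₀)
    (hDm : Measurable D) (hDb : ∀ x, |D x| ≤ CD) (hSm : Measurable S) (hSb : ∀ x, |S x| ≤ CS) {γ V : ℝ} (hγ : 0 < γ) (hV : 0 < V)
    (hresp : ∀ u ∈ Set.Icc (0 : ℝ) 1, ∀ v ∈ Set.Icc (-V) V, γ ≤ cov[R, S; μ.tilted fun x => s * F x + u * D x + v * S x])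
    (hbracket : ∀ u ∈ Set.Icc (0 : ℝ) 1, ∫ x, R x ∂(μ.tilted fun x => s * F x + u * D x + (-V) * S x) ≤ (1 - u) * r₀ + u * r₁ ∧
      (1 - u) * r₀ + u * r₁ ≤ ∫ x, R x ∂(μ.tilted fun x => s * F x + u * D x + V * S x))
    (h0 : ∫ x, R x ∂(μ.tilted fun x => s * F x) = r₀) (h1 : ∫ x, R x ∂(μ.tilted fun x => s * F x + D x) = r₁) :
    ∃ κ κ' : ℝ → ℝ, (∀ u, HasDerivAt κ (κ' u) u) ∧ Continuous κ' ∧ κ 0 = 0 ∧ κ 1 = 0 ∧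
      (∀ u ∈ Set.Icc (0 : ℝ) 1, κ u ∈ Set.Icc (-V) V) ∧
      ∀ u ∈ Set.Icc (0 : ℝ) 1, ∫ x, R x ∂(μ.tilted fun x => s * F x + u * D x + κ u * S x) = (1 - u) * r₀ + u * r₁ := by
  set G : ℝ → ℝ → ℝ := fun u v => (∫ x, R x ∂(μ.tilted fun x => s * F x + u * D x + v * S x)) - ((1 - u) * r₀ + u * r₁) with hG
  have haff : ∀ u : ℝ, HasDerivAt (fun t : ℝ => (1 - t) * r₀ + t * r₁) (r₁ - r₀) u := fun u => by
    have h := (((hasDerivAt_id u).const_sub 1).mul_const r₀).add ((hasDerivAt_id u).mul_const r₁)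
    exact (h.congr_of_eventuallyEq (Eventually.of_forall fun t => rfl)).congr_deriv (by ring)
  have hGu : ∀ u v, HasDerivAt (fun t => G t v) (cov[R, D; μ.tilted fun x => s * F x + u * D x + v * S x] - (r₁ - r₀)) u := fun u v =>
    (hasDerivAt_integral_chord_u (μ := μ) (s := s) hRm hRb hFm hFb hDm hDb hSm hSb u v).sub (haff u)
  have hGv : ∀ u v, HasDerivAt (fun t => G u t) (cov[R, S; μ.tilted fun x => s * F x + u * D x + v * S x]) v := fun u v =>
    (hasDerivAt_integral_chord_v (μ := μ) (s := s) hRm hRb hFm hFb hDm hDb hSm hSb u v).sub_const _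
  have hG0 : G 0 0 = 0 := by
    have e : (fun x => s * F x + (0 : ℝ) * D x + (0 : ℝ) * S x) = fun x => s * F x := by funext x; ring
    simp only [hG, e, h0]; ring
  have hG1 : G 1 0 = 0 := by
    have e : (fun x => s * F x + (1 : ℝ) * D x + (0 : ℝ) * S x) = fun x => s * F x + D x := by funext x; ring
    simp only [hG, e, h1]; ring
  have hbr : ∀ u ∈ Icc (0 : ℝ) 1, G u (-V) ≤ 0 ∧ 0 ≤ G u V := fun u hu =>
    ⟨sub_nonpos.2 (hbracket u hu).1, sub_nonneg.2 (hbracket u hu).2⟩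
  have hcu : Continuous (Function.uncurry fun u v => cov[R, D; μ.tilted fun x => s * F x + u * D x + v * S x] - (r₁ - r₀)) :=
    (continuous_cov_chord hRm hRb hDm hDb hFm hFb hDm hDb hSm hSb).sub continuous_const
  obtain ⟨κ, κ', hκd, hκ'c, hκ0, hκ1, hκm, hκz⟩ := exists_C1_zeroCurve (G := G) hγ hV hGu hGv hcu
    (continuous_cov_chord hRm hRb hSm hSb hFm hFb hDm hDb hSm hSb) hresp hbr hG0 hG1
  exact ⟨κ, κ', hκd, hκ'c, hκ0, hκ1, hκm, fun u hu => sub_eq_zero.1 (hκz u hu)⟩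

/-- **THE BRACKET FROM THE STRAIGHT CHORD's DETUNING**: if along the STRAIGHT chord (`v = 0`) the renormalisation observable never leaves the affine target by more
than the window's reach, `|∫ R dμ.tilted (sF + uD) − ((1−u)r₀ + u r₁)| ≤ γ·V` on `[0,1]`, then the uniform response `Cov_{u,v}(R,S) ≥ γ` on `[0,1] × [-V,V]` brackets the
target at `v = ±V` (growth `γ·V` in each direction) — so the tuned path exists INSIDE the window. [folklore ∘ growth lemma + `exists_tuned_path_affine`] -/
theorem exists_tuned_path_affine_of_detuning (hRm : Measurable R) (hRb : ∀ x, |R x| ≤ CR) (hFm : Measurable F) (hFb : ∀ x, |F x| ≤ B₀)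
    (hDm : Measurable D) (hDb : ∀ x, |D x| ≤ CD) (hSm : Measurable S) (hSb : ∀ x, |S x| ≤ CS) {γ V : ℝ} (hγ : 0 < γ) (hV : 0 < V)
    (hresp : ∀ u ∈ Set.Icc (0 : ℝ) 1, ∀ v ∈ Set.Icc (-V) V, γ ≤ cov[R, S; μ.tilted fun x => s * F x + u * D x + v * S x])
    (hdetune : ∀ u ∈ Set.Icc (0 : ℝ) 1, |(∫ x, R x ∂(μ.tilted fun x => s * F x + u * D x)) - ((1 - u) * r₀ + u * r₁)| ≤ γ * V)
    (h0 : ∫ x, R x ∂(μ.tilted fun x => s * F x) = r₀) (h1 : ∫ x, R x ∂(μ.tilted fun x => s * F x + D x) = r₁) :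
    ∃ κ κ' : ℝ → ℝ, (∀ u, HasDerivAt κ (κ' u) u) ∧ Continuous κ' ∧ κ 0 = 0 ∧ κ 1 = 0 ∧
      (∀ u ∈ Set.Icc (0 : ℝ) 1, κ u ∈ Set.Icc (-V) V) ∧
      ∀ u ∈ Set.Icc (0 : ℝ) 1, ∫ x, R x ∂(μ.tilted fun x => s * F x + u * D x + κ u * S x) = (1 - u) * r₀ + u * r₁ := by
  refine exists_tuned_path_affine hRm hRb hFm hFb hDm hDb hSm hSb hγ hV hresp (fun u hu => ?_) h0 h1
  -- growth `γ·V` from `v = 0` to `v = ±V` along the `v`-family at this `u`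
  set Φ : ℝ → ℝ := fun v => ∫ x, R x ∂(μ.tilted fun x => s * F x + u * D x + v * S x) with hΦ
  have hderiv : ∀ u' v, HasDerivAt (fun t => (fun u'' t' => ∫ x, R x ∂(μ.tilted fun x => s * F x + u'' * D x + t' * S x)) u' t)
      (cov[R, S; μ.tilted fun x => s * F x + u' * D x + v * S x]) v := fun u' v =>
    hasDerivAt_integral_chord_v (μ := μ) (s := s) hRm hRb hFm hFb hDm hDb hSm hSb u' v
  have h0V : (0 : ℝ) ∈ Icc (-V) V := ⟨by linarith, hV.le⟩
  have hVV : V ∈ Icc (-V) V := ⟨by linarith, le_rfl⟩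
  have hmV : -V ∈ Icc (-V) V := ⟨le_rfl, by linarith⟩
  have hup := mul_sub_le_sub_of_resp (G := fun u'' t' => ∫ x, R x ∂(μ.tilted fun x => s * F x + u'' * D x + t' * S x))
    hderiv (hresp u hu) h0V hVV hV.le
  have hdn := mul_sub_le_sub_of_resp (G := fun u'' t' => ∫ x, R x ∂(μ.tilted fun x => s * F x + u'' * D x + t' * S x))
    hderiv (hresp u hu) hmV h0V (by linarith)
  have e0 : (fun x => s * F x + u * D x + (0 : ℝ) * S x) = fun x => s * F x + u * D x := by funext x; ring
  simp only [e0, sub_zero, zero_sub, neg_neg] at hup hdn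
  have hd := abs_le.1 (hdetune u hu)
  constructor <;> linarith

/-- **K11c′ FROM THE DETUNING** (equal endpoints): `exists_tuned_path`'s bracket hypothesis replaced by the straight chord's detuning bound `|∫ R dμ.tilted (sF + uD) − r| ≤ γ·V`. -/
theorem exists_tuned_path_of_detuning (hRm : Measurable R) (hRb : ∀ x, |R x| ≤ CR) (hFm : Measurable F) (hFb : ∀ x, |F x| ≤ B₀)
    (hDm : Measurable D) (hDb : ∀ x, |D x| ≤ CD) (hSm : Measurable S) (hSb : ∀ x, |S x| ≤ CS) {γ V r : ℝ} (hγ : 0 < γ) (hV : 0 < V)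
    (hresp : ∀ u ∈ Set.Icc (0 : ℝ) 1, ∀ v ∈ Set.Icc (-V) V, γ ≤ cov[R, S; μ.tilted fun x => s * F x + u * D x + v * S x])
    (hdetune : ∀ u ∈ Set.Icc (0 : ℝ) 1, |(∫ x, R x ∂(μ.tilted fun x => s * F x + u * D x)) - r| ≤ γ * V)
    (h0 : ∫ x, R x ∂(μ.tilted fun x => s * F x) = r) (h1 : ∫ x, R x ∂(μ.tilted fun x => s * F x + D x) = r) :
    ∃ κ κ' : ℝ → ℝ, (∀ u, HasDerivAt κ (κ' u) u) ∧ Continuous κ' ∧ κ 0 = 0 ∧ κ 1 = 0 ∧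
      (∀ u ∈ Set.Icc (0 : ℝ) 1, κ u ∈ Set.Icc (-V) V) ∧
      ∀ u ∈ Set.Icc (0 : ℝ) 1, ∫ x, R x ∂(μ.tilted fun x => s * F x + u * D x + κ u * S x) = r := by
  have h := exists_tuned_path_affine_of_detuning (r₀ := r) (r₁ := r) hRm hRb hFm hFb hDm hDb hSm hSb hγ hV hresp
    (fun u hu => by have := hdetune u hu; simpa only [show (1 - u) * r + u * r = r by ring] using this) h0 h1
  simpa only [show ∀ u : ℝ, (1 - u) * r + u * r = r from fun u => by ring] using h

end Affine

end YMDAG.N14.LawChannelTunedPath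

end
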